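import Literature.AlgebraicGeometry.HodgeTheory.HodgeGenericQbarDescentFiniteMonodromyInputs
import Literature.AlgebraicGeometry.FundamentalGroup.RiemannExistenceQbarDescentProofs
import Literature.AlgebraicGeometry.FundamentalGroup.RiemannExistenceCovering
import Literature.AlgebraicGeometry.HodgeTheory.LefschetzOneOneHolds
import HarnessLib

/-!
# Divisor classes on a finite étale base change spanning the cohomology of a fibre (monodromy route)

Family `hodge`, layer `Literature/AlgebraicGeometry/HodgeTheory`. PROOF FILE (theorems only; no
definition, no named fact — D-0026). Part (M2) of the monodromy route to the smooth part of
Arapura's Cor. 1.5 (`ArapuraSurfaceFibredFourfoldsSplit.lean`, consumed through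
`Arapura2022_thm_1_2_smoothPart_pgZeroSurfaceFibration_of_affineFiniteEtaleBaseChange`): the
sentence "after a finite base change, `[𝒵_1], …, [𝒵_N]` gives a basis of `R²f_*ℚ`" of the printed
proof (Arapura 2022, p. 5; there via relative Hilbert schemes, as in Voisin, *Hodge Theory II*,
proof of Prop. 11.15), obtained here by the MONODROMY ARGUMENT (Voisin 2007, §3, proof of Prop. 0.7:
"there is an étale cover … on which this monodromy action becomes trivial. Thus we have by base
change a family … together with a global section `α̃` … The global invariant cycle theorem now says
that there exists a Hodge class `β` on a smooth compactification … restricting to `α`"), GRANTED the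
two named facts of the tree it rests on:

* `FundamentalGroup.riemannExistence_finiteCovering` — Riemann's existence theorem over `ℂ` in
  covering form [SGA1, Exp. XII Thm. 5.1];
* `deligne_globalInvariantCycles` — Deligne's théorème de la partie fixe [Hodge II, Thm. 4.1.1].

Main result `exists_finiteEtale_algebraicClasses_span_of_finite_monodromy (hRE) (hGIC)`: let
`f : 𝒳 ⟶ S` be a smooth projective family of SURFACES over a smooth irreducible quasi-projective
complex base with `𝒳` quasi-projective, `s ∈ S(ℂ)`, and `α_1, …, α_N` RATIONAL `(1,1)`-classes of
`H²(X_s(ℂ); ℂ)` each with FINITE monodromy orbit, spanning `H²(X_s(ℂ); ℂ)`. Then there are a finite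
étale surjective `g : S' ⟶ S` with `S'` irreducible, a point `s' ∈ S'(ℂ)` and classes
`ζ_1, …, ζ_N ∈ N¹H²((𝒳 ×_S S')(ℂ); ℂ) = algebraicClasses (familyPullback f g) 1` whose restrictions to
the fibre of `𝒳 ×_S S' ⟶ S'` over `s'` span its `H²`. Steps (all tree theorems but the two facts):
finite orbits ⟹ a finite-index subgroup of `π₁(S(ℂ), s)` fixing every `α_i`
(`exists_finiteIndex_of_finite_setOf_isContinuationAlong_of_isSmoothProjectiveFamily`, intersected
over `i`); the covering attached to its normal core (`UniversalCover.exists_covering_of_normal`,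
Hatcher Prop. 1.36); Riemann existence (`hRE`) ⟹ `S'`; base change and invariant continuous
sections (`exists_continuous_section_familyPullback`); a smooth projective compactification of
`𝒳 ×_S S'` (`exists_isSmoothProjective_isOpenImmersion`, Hironaka, PROVED in the tree); the Hodge
lift (`deligne_globalInvariantCycles.exists_hodgeClass_eq_globalSection_of_exists_isReal_hodgeModel`
with `smoothProjective_hodgeStructure_isPolarizable_holds`); Lefschetz `(1,1)`
(`lefschetzOneOne_rational_holds`) and restriction to the open part
(`map_mem_algebraicClasses_of_isOpenImmersion`).

Also: `surjective_of_isFinite_of_etale_of_irreducible` (a finite étale morphism from a non-empty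
scheme onto an irreducible scheme is surjective: locally constant rank),
`connectedSpace_complexPoints_of_irreducibleSpace` (SGA1 XII 2.4 on the tree's carriers).

## References

* [Arapura2022] D. Arapura, Hodge cycles and the Leray filtration, Pacific J. Math. 319 (2022),
  proof of Cor. 1.5 (p. 5).
* [Voisin2007HodgeLoci] C. Voisin, Hodge loci and absolute Hodge classes, Compositio Math. 143
  (2007), §3, proof of Prop. 0.7.
* [VoisinHodgeII2003] C. Voisin, Hodge Theory and Complex Algebraic Geometry II, CUP 2003, §3.1.2,
  Lemma 4.17, Thm. 4.24, proof of Prop. 11.15.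
* [SGA1] A. Grothendieck, M. Raynaud, SGA 1, Exp. XII Thm. 5.1, Prop. 2.4, Prop. 3.1 (iii).
* [DeligneHodgeII1971] P. Deligne, Théorie de Hodge II, Thm. 4.1.1.
* [HatcherAT2002] A. Hatcher, Algebraic Topology, §1.3 Prop. 1.32, Prop. 1.36.
* [StacksProject] Tag 02KA (rank of a finite locally free morphism).
-/

noncomputable section

open CategoryTheory AlgebraicGeometry
open _root_.Topology
open Literature.AlgebraicTopology.SingularHomology
open Literature.Topology.CoveringSpaces

namespace Literature.AlgebraicGeometry.HodgeTheory

open Literature.AlgebraicGeometry.Motives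

/-! ### Two scheme-theoretic preliminaries -/

section Preliminaries

/-- **A finite étale morphism from a non-empty scheme to an irreducible scheme is surjective**: its
rank is locally constant on the (connected) target and `≥ 1` at a point of the image (Mathlib
`Scheme.Hom.one_le_finrank_map`, `Scheme.Hom.one_le_finrank_iff_surjective`).
[cite: StacksProject, Tag 02KA] -/
theorem surjective_of_isFinite_of_etale_of_irreducible {Y X : Scheme} (π : Y ⟶ X) [IsFinite π]
    [Etale π] [Nonempty Y] [IrreducibleSpace X] : Surjective π := by
  obtain ⟨y⟩ := ‹Nonempty Y›
  have hlc := Scheme.Hom.isLocallyConstant_finrank π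
  rw [← Scheme.Hom.one_le_finrank_iff_surjective, Pi.le_def]
  intro x
  rw [Pi.one_apply, hlc.apply_eq_of_preconnectedSpace x (π y)]
  exact Scheme.Hom.one_le_finrank_map π y

/-- **The complex points of an irreducible `ℂ`-scheme locally of finite type form a connected
space** (analytic topology; SGA1 XII Prop. 2.4 — the tree's proved
`Motives.ComplexPoints.isConnected_setOf_pt_mem_of_isIrreducible_holds` for the closed irreducible
subset `univ`). [cite: SGA1, Exp. XII Prop. 2.4] -/
theorem connectedSpace_complexPoints_of_irreducibleSpace (X : SchemeOver ℂ) [LocallyOfFiniteType X.hom]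
    [IrreducibleSpace X.left] : ConnectedSpace (ComplexPoints X) := by
  have h := Motives.ComplexPoints.isConnected_setOf_pt_mem_of_isIrreducible_holds X isClosed_univ
    (IrreducibleSpace.isIrreducible_univ (X := ↥X.left))
  rw [connectedSpace_iff_univ]
  convert h using 1
  ext P
  simp

end Preliminaries

/-! ### The finite étale base change trivialising the monodromy of finitely many classes -/

section BaseChange

/-- **Riemann existence, finite-index form over `ℂ`, from the covering form.** Granted
`FundamentalGroup.riemannExistence_finiteCovering` (SGA1 XII Thm. 5.1): for a smooth irreducible
quasi-projective `ℂ`-scheme `S`, `s ∈ S(ℂ)` and a finite-index subgroup `H ≤ π₁(S(ℂ), s)` (on the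
subspace `univ ⊆ S(ℂ)`, as the tree's transport), there are a FINITE ÉTALE `g : S' ⟶ S` with `S'(ℂ)`
path connected, a point `s'` over `s`, and every loop at `s'` maps by `g(ℂ)` into `H`: the covering
of the connected manifold `S(ℂ)` attached to the normal core of `H` (Hatcher Prop. 1.36 / 1.32, the
tree's `UniversalCover.exists_covering_of_normal`) is `S'(ℂ)` over `S(ℂ)` by the fact. This is the
`ℂ`-half of `FundamentalGroup.riemannExistence_qbarDescent_of_finiteIndex_of_coveringInput`
(no descent). [cite: SGA1, Exp. XII Thm. 5.1 (p. 333)]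
[cite: HatcherAT2002, §1.3 Prop. 1.36 and Prop. 1.32] -/
theorem exists_finiteEtale_of_finiteIndex_of_riemannExistence
    (hRE : FundamentalGroup.riemannExistence_finiteCovering) (S : SchemeOver ℂ)
    (hS : IsQuasiProjectiveOver S) [IrreducibleSpace S.left] (d : ℕ) [SmoothOfRelativeDimension d S.hom]
    (s : ComplexPoints S)
    (H : Subgroup (FundamentalGroup (Set.univ : Set (ComplexPoints S)) ⟨s, Set.mem_univ s⟩))
    [H.FiniteIndex] :
    ∃ (S' : SchemeOver ℂ) (g : S' ⟶ S) (s' : ComplexPoints S') (hs : AlgPoints.map g s' = s),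
      IsFinite g.left ∧ Etale g.left ∧ PathConnectedSpace (ComplexPoints S') ∧
      ∀ γ' : Path (⟨s', Set.mem_univ s'⟩ : (Set.univ : Set (ComplexPoints S'))) ⟨s', Set.mem_univ s'⟩,
        FundamentalGroup.fromPath
          (⟦(γ'.map ((((AlgPoints.continuous_map g).comp continuous_subtype_val)).subtype_mk
              fun _ ↦ Set.mem_univ _)).cast (Subtype.ext hs.symm) (Subtype.ext hs.symm)⟧) ∈ H := by
  -- (i) `S(ℂ)` is a connected topological manifold: path connected, strongly locally contractible
  haveI : LocallyOfFiniteType S.hom := hS.locallyOfFiniteType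
  letI := Motives.ComplexPoints.chartedSpace S d
  haveI : StronglyLocallyContractibleSpace (ComplexPoints S) :=
    Literature.AlgebraicTopology.Homotopy.stronglyLocallyContractibleSpace_of_chartedSpace_normedSpace
      (EuclideanSpace ℝ (Fin (2 * d))) _
  haveI : ConnectedSpace (ComplexPoints S) := connectedSpace_complexPoints_of_irreducibleSpace S
  haveI : PathConnectedSpace (ComplexPoints S) := pathConnectedSpace_complexPoints_of_smoothOfRelativeDimension S d
  haveI : StronglyLocallyContractibleSpace (Set.univ : Set (ComplexPoints S)) :=
    isOpen_univ.stronglyLocallyContractibleSpace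
  haveI : PathConnectedSpace (Set.univ : Set (ComplexPoints S)) :=
    isPathConnected_iff_pathConnectedSpace.mp isPathConnected_univ
  -- (ii) the covering attached to the normal core `N ⊴ π₁(S(ℂ), s)` of `H` (Hatcher 1.36, 1.32)
  obtain ⟨T, _, q, hqc, t, ht, hcov, hTpc, hfin, hloop⟩ :=
    UniversalCover.exists_covering_of_normal (X := (Set.univ : Set (ComplexPoints S)))
      (x₀ := ⟨s, Set.mem_univ s⟩) H.normalCore
  haveI := hTpc
  let φ := Homeomorph.Set.univ (ComplexPoints S)
  have hcov' : IsCoveringMap (φ ∘ q) := hcov.homeomorph_comp φ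
  have hfin' : ∀ x, ((φ ∘ q) ⁻¹' {x}).Finite := fun x ↦ by
    refine (hfin (φ.symm x)).subset fun y hy ↦ ?_
    simp only [Set.mem_preimage, Set.mem_singleton_iff, Function.comp_apply] at hy ⊢
    rw [← hy, Homeomorph.symm_apply_apply]
  -- (iii) Riemann existence: `T = S'(ℂ)` over `S(ℂ)` for a finite étale `g : S' ⟶ S`
  obtain ⟨S', g, Φ, hgfin, hget, hΦ⟩ := hRE S hS T (φ ∘ q) hcov' hfin'
  -- the base point `s'` matching `t`
  have hs : AlgPoints.map g (Φ.symm t) = s := by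
    rw [← hΦ (Φ.symm t), Φ.apply_symm_apply, Function.comp_apply, ht]
    rfl
  haveI : PathConnectedSpace (ComplexPoints S') :=
    Φ.symm.surjective.pathConnectedSpace Φ.symm.continuous
  refine ⟨S', g, Φ.symm t, hs, hgfin, hget, inferInstance, fun γ' ↦ ?_⟩
  -- the loop clause: `g(ℂ) ∘ γ'` is `q ∘ δ` for the loop `δ = Φ ∘ γ'` at `t`
  let δ : Path t t :=
    (γ'.map (Φ.continuous.comp continuous_subtype_val)).cast (Φ.apply_symm_apply t).symm
      (Φ.apply_symm_apply t).symm
  have hpath :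
      ((γ'.map ((((AlgPoints.continuous_map g).comp continuous_subtype_val)).subtype_mk
          fun _ ↦ Set.mem_univ _)).cast (Subtype.ext hs.symm) (Subtype.ext hs.symm) :
        Path (⟨s, Set.mem_univ s⟩ : (Set.univ : Set (ComplexPoints S))) ⟨s, Set.mem_univ s⟩) =
      (δ.map hqc).cast ht.symm ht.symm := by
    apply Path.ext
    funext u
    apply Subtype.ext
    change AlgPoints.map g (γ' u).1 = (φ ∘ q) (Φ (γ' u).1)
    exact (hΦ _).symm
  rw [hpath]
  exact H.normalCore_le (hloop δ)

/-- **Divisor classes on a finite étale base change spanning the cohomology of a fibre — the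
monodromy argument** ("after a finite base change, `[𝒵_1], …, [𝒵_N]` gives a basis of `R²f_*ℚ`",
Arapura 2022, proof of Cor. 1.5), GRANTED Riemann's existence theorem over `ℂ`
(`FundamentalGroup.riemannExistence_finiteCovering`) and the global invariant cycle theorem
(`deligne_globalInvariantCycles`). Let `f : 𝒳 ⟶ S` be a smooth projective family of relative
dimension `2` over a smooth irreducible quasi-projective `ℂ`-scheme `S`, with `𝒳` quasi-projective,
`s ∈ S(ℂ)`, and `α : Fin N → H²(X_s(ℂ); ℂ)` RATIONAL classes of type `(1,1)`, each with FINITE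
monodromy orbit, spanning `H²(X_s(ℂ); ℂ)`. Then there are a finite étale SURJECTIVE `g : S' ⟶ S`
with `S'` irreducible, `s' ∈ S'(ℂ)` and classes `ζ_i ∈ algebraicClasses (𝒳 ×_S S') 1` whose
restrictions to the fibre of `𝒳 ×_S S' ⟶ S'` over `s'` span its `H²`. Proof (Voisin 2007, §3,
proof of Prop. 0.7, for the finite family): a finite-index subgroup of `π₁(S(ℂ), s)` fixes every
`α_i`; its cover `g : S' ⟶ S` (`exists_finiteEtale_of_finiteIndex_of_riemannExistence`); on
`𝒳 ×_S S' ⟶ S'` the transfers `α'_i = e^* α_i` (`e` the fibre isomorphism) are monodromy invariant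
and extend to continuous sections (`exists_continuous_section_familyPullback`); `𝒳 ×_S S'` is smooth
quasi-projective irreducible, so embeds openly in a smooth projective `𝒳̄`
(`exists_isSmoothProjective_isOpenImmersion`); the Hodge lift gives rational `(1,1)` classes
`β_i` on `𝒳̄` restricting to `α'_i`
(`deligne_globalInvariantCycles.exists_hodgeClass_eq_globalSection_of_exists_isReal_hodgeModel`),
divisor classes by Lefschetz `(1,1)` (`lefschetzOneOne_rational_holds`), whose restrictions
`ζ_i` to `𝒳 ×_S S'` are divisor classes (`map_mem_algebraicClasses_of_isOpenImmersion`) restricting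
on the fibre to `e^* α_i`, which span since `e^*` is an isomorphism.
[cite: Arapura2022, proof of Cor. 1.5 (p. 5)] [cite: Voisin2007HodgeLoci, §3, proof of Prop. 0.7]
[cite: VoisinHodgeII2003, Lemma 4.17 and Thm. 4.24] [cite: SGA1, Exp. XII Thm. 5.1]
[cite: DeligneHodgeII1971, Théorème 4.1.1] -/
theorem exists_finiteEtale_algebraicClasses_span_of_finite_monodromy
    (hRE : FundamentalGroup.riemannExistence_finiteCovering) (hGIC : deligne_globalInvariantCycles)
    {𝒳 S : SchemeOver ℂ} (f : 𝒳 ⟶ S) (hf : IsSmoothProjectiveFamily f 2)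
    (h𝒳 : IsQuasiProjectiveOver 𝒳) (hS : IsQuasiProjectiveOver S) [IrreducibleSpace S.left]
    [Smooth S.hom] (s : ComplexPoints S) {N : ℕ} (α : Fin N → complexBetti (fiberOver f s) (2 * 1))
    (hαr : ∀ i, IsRationalClass (α i)) (hαh : ∀ i, IsOfHodgeType 2 (fiberOver f s) (2 * 1) 1 1 (α i))
    (hfin : ∀ i, {β : complexBetti (fiberOver f s) (2 * 1) |
      ∃ γ : Path s s, IsContinuationAlong γ (α i) β}.Finite)
    (hspan : Submodule.span ℂ (Set.range α) = ⊤) :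
    ∃ (S' : SchemeOver ℂ) (g : S' ⟶ S) (_ : IsFinite g.left) (_ : Etale g.left) (_ : Surjective g.left)
      (_ : IrreducibleSpace S'.left) (s' : ComplexPoints S')
      (ζ : Fin N → complexBetti (familyPullback f g) (2 * 1)),
      (∀ i, ζ i ∈ algebraicClasses (familyPullback f g) 1) ∧
      Submodule.span ℂ (Set.range fun i ↦
        complexBetti.map (fiberι (familyPullback.snd f g) s') (2 * 1) (ζ i)) = ⊤ := by
  -- Step 0: the base `S` is smooth of a pure dimension `d`, separated, locally of finite type
  obtain ⟨d, hd⟩ := Motives.exists_smoothOfRelativeDimension_of_smooth S.hom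
  haveI := hd
  haveI : LocallyOfFiniteType S.hom := hS.locallyOfFiniteType
  haveI : IsSeparated S.hom := hS.isVarietyPair_ofScheme.isSeparated
  have hU := isCohomologicallyLocallyTrivialOn_univ_of_isSmoothProjectiveFamily f d hf hS
  -- Step 1 (the orbits): a finite-index subgroup `H₀ ≤ π₁(S(ℂ), s)` fixing every `α i`
  have hH : ∀ i, ∃ H : Subgroup (FundamentalGroup (Set.univ : Set (ComplexPoints S)) ⟨s, Set.mem_univ s⟩),
      H.FiniteIndex ∧ ∀ γ ∈ H, transportFun f (2 * 1) hU (FundamentalGroup.toPath γ) (α i) = α i :=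
    fun i ↦ exists_finiteIndex_of_finite_setOf_isContinuationAlong_of_isSmoothProjectiveFamily f (2 * 1)
      d hf hS s (α i) (hfin i)
  choose H hHfi hHfix using hH
  haveI : (⨅ i, H i).FiniteIndex := Subgroup.finiteIndex_iInf hHfi
  -- Step 2 (the étale cover `S' → S`): Riemann existence for `H₀ = ⨅ H i`
  obtain ⟨S', g, s', hs, hgfin, hget, hS'pc, hloops⟩ :=
    exists_finiteEtale_of_finiteIndex_of_riemannExistence hRE S hS d s (⨅ i, H i)
  subst hs
  haveI := hgfin
  haveI := hget
  haveI := hS'pc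
  -- Step 3: `S'` is smooth of pure dimension `d`, irreducible, quasi-projective; `g` is surjective;
  -- `g(ℂ)` is a local homeomorphism; `S'(ℂ)` is a connected manifold
  haveI hg0 : SmoothOfRelativeDimension 0 g.left := inferInstance
  haveI : AlgebraicGeometry.Smooth g.left := SmoothOfRelativeDimension.smooth 0 _
  haveI hS'd : SmoothOfRelativeDimension d S'.hom := by
    have h : SmoothOfRelativeDimension (0 + d) (g.left ≫ S.hom) := inferInstance
    rw [Over.w] at h
    simpa using h
  haveI : AlgebraicGeometry.Smooth S'.hom := SmoothOfRelativeDimension.smooth d _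
  haveI : ConnectedSpace (ComplexPoints S') := inferInstance
  haveI hS'irr : IrreducibleSpace S'.left := irreducibleSpace_left_of_connectedSpace_complexPoints
  haveI : Nonempty S'.left := inferInstance
  haveI hgsurj : Surjective g.left := surjective_of_isFinite_of_etale_of_irreducible g.left
  haveI : IsReduced S.left := Motives.isReduced_of_smooth_over_field S.hom
  haveI : IsReduced S'.left := Motives.isReduced_of_smooth_over_field S'.hom
  haveI : IsIntegral S.left := isIntegral_of_irreducibleSpace_of_isReduced S.left
  haveI : IsIntegral S'.left := isIntegral_of_irreducibleSpace_of_isReduced S'.left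
  have hS'qp : IsQuasiProjectiveOver S' := isQuasiProjectiveOver_of_isFinite_of_surjective g hS
  haveI : LocallyOfFiniteType S'.hom := hS'qp.locallyOfFiniteType
  letI := Motives.ComplexPoints.chartedSpace S' d
  haveI : LocallyPathConnectedSpace (ComplexPoints S') :=
    ChartedSpace.locallyPathConnectedSpace (EuclideanSpace ℝ (Fin (2 * d))) _
  have hgloc : IsLocalHomeomorph (AlgPoints.map g : ComplexPoints S' → ComplexPoints S) :=
    Motives.ComplexPoints.isLocalHomeomorph_map d _
  -- Step 4 (base change of the family): `f' : 𝒳 ×_S S' ⟶ S'`, its local system, the fibre `e`,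
  -- the invariant transfers `e^* α i` and their continuous sections
  set π' := familyPullback.snd f g with hπ'
  have hf' : IsSmoothProjectiveFamily π' 2 := hf.familyPullback_snd g
  have hU' := isCohomologicallyLocallyTrivialOn_univ_of_isSmoothProjectiveFamily π' d hf' hS'qp
  set e := fiberOverFamilyPullbackIso f g s' with he
  have hinv : ∀ (i : Fin N) (γ' : Path (⟨s', Set.mem_univ s'⟩ :
      (Set.univ : Set (ComplexPoints S'))) ⟨s', Set.mem_univ s'⟩),
      transportFun f (2 * 1) hU
        (s := ⟨AlgPoints.map g s', Set.mem_univ _⟩) (t := ⟨AlgPoints.map g s', Set.mem_univ _⟩)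
        ⟦γ'.map ((((AlgPoints.continuous_map g).comp continuous_subtype_val)).subtype_mk
          fun _ ↦ Set.mem_univ _)⟧ (α i) = α i :=
    fun i γ' ↦ hHfix i _ (iInf_le (fun i ↦ H i) i (hloops γ'))
  have hsec : ∀ i, ∃ σ' : ComplexPoints S' → FiberClass π' (2 * 1),
      Continuous σ' ∧ (∀ t, (σ' t).pt = t) ∧ σ' s' = ⟨s', complexBetti.map e.hom (2 * 1) (α i)⟩ :=
    fun i ↦ exists_continuous_section_familyPullback f g (2 * 1) hgloc hU hU' s'
      (complexBetti.map e.hom (2 * 1) (α i)) (FiberClass.cls_baseChange_map_hom _ _ _ s' (α i)) (hinv i)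
  choose σ hσc hσpt hσ₀ using hsec
  have h₀ : ∀ i, σ i s' ∈ locusOfHodgeClasses π' 2 1 := fun i ↦ by
    rw [hσ₀]
    exact ⟨(hαr i).map _, (hαh i).map_of_iso e⟩
  -- Step 5 (a smooth projective compactification of `𝒳 ×_S S'`): Hironaka, proved in the tree
  haveI := hf'.smoothOfRelativeDimension
  haveI : SmoothOfRelativeDimension (2 + d) (familyPullback f g).hom := by
    rw [← Over.w π']
    infer_instance
  haveI : IrreducibleSpace (familyPullback f g).left := irreducibleSpace_of_isSmoothProjectiveFamily π' hf'
  have hV'qp : IsQuasiProjectiveOver (familyPullback f g) :=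
    isQuasiProjectiveOver_familyPullback_of_isSeparated f g h𝒳 hS'qp
  obtain ⟨Xbar, i, hXbar, hi⟩ :=
    exists_isSmoothProjective_isOpenImmersion (2 + d) (familyPullback f g) inferInstance hV'qp inferInstance
  haveI := hi
  -- Step 6 (global invariant cycles + Hodge lift): rational `(1,1)` classes `β i` on `𝒳̄`
  have hβ : ∀ i', ∃ β : complexBetti Xbar (2 * 1), IsRationalClass β ∧ IsOfHodgeType (2 + d) Xbar (2 * 1) 1 1 β ∧
      σ i' s' = globalSection π' (2 * 1) (complexBetti.map i (2 * 1) β) s' := fun i' ↦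
    hGIC.exists_hodgeClass_eq_globalSection_of_exists_isReal_hodgeModel exists_isReal_hodgeModel_holds
      hodgePQ_independent_of_hodgeModel_holds smoothProjective_hodgeStructure_isPolarizable_holds π' i
      hf' hS'qp (SmoothOfRelativeDimension.smooth d _) hXbar hi (hσc i') (hσpt i') (h₀ i')
  choose β hβr hβh hβσ using hβ
  -- Step 7 (Lefschetz (1,1) on `𝒳̄`, restriction to the open part): the divisor classes `ζ i`
  have hβalg : ∀ i', β i' ∈ algebraicClasses Xbar 1 := fun i' ↦
    lefschetzOneOne_rational_holds hXbar (β i') (hβr i') (hβh i')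
  refine ⟨S', g, hgfin, hget, hgsurj, hS'irr, s', fun i' ↦ complexBetti.map i (2 * 1) (β i'),
    fun i' ↦ map_mem_algebraicClasses_of_isOpenImmersion hXbar i (hβalg i'), ?_⟩
  -- Step 8 (the span): on the fibre over `s'`, `ζ i` restricts to `e^* α i`, and `e^*` is onto
  have hres : ∀ i', complexBetti.map (fiberι π' s') (2 * 1) (complexBetti.map i (2 * 1) (β i')) =
      complexBetti.map e.hom (2 * 1) (α i') := fun i' ↦ by
    have h1 := (hσ₀ i').symm.trans (hβσ i')
    exact ((FiberClass.mk_eq_mk_iff _ _).1 h1).symm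
  have hrange : (Set.range fun i' ↦ complexBetti.map (fiberι π' s') (2 * 1) (complexBetti.map i (2 * 1) (β i'))) =
      (complexBetti.map e.hom (2 * 1)).hom '' Set.range α := by
    rw [← Set.range_comp]
    exact congrArg Set.range (funext fun i' ↦ hres i')
  rw [hrange, Submodule.span_image, hspan, Submodule.map_top, LinearMap.range_eq_top]
  exact fun c ↦ ⟨complexBetti.map e.inv (2 * 1) c, e.complexBetti_map_hom_map_inv (2 * 1) c⟩

end BaseChange

end Literature.AlgebraicGeometry.HodgeTheory

end
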